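import Literature.Analysis.FluidPDE.Antidivergence
import Literature.Analysis.FluidPDE.FractionalNSTorus
import Literature.Analysis.FunctionSpaces.TorusCalculusProofs
import Literature.Analysis.FunctionSpaces.TorusLerayHelmholtz
import Literature.Analysis.FunctionSpaces.TorusInverseLaplacianCalculus
import HarnessLib

/-!
# `L^p` bounds for the constant-coefficient operators of the intermittent convex-integration
  scheme on the flat torus (named facts)

Analysis/FluidPDE facts file. The proof of the Iteration Lemma of T. Luo and E. S. Titi
(Calc. Var. PDE 59 (2020) = arXiv:1808.07595, §3 — `Torus.LuoTiti2020_iterationLemma` of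
`FluidPDE/FractionalNSReynolds`), like Buckmaster–Vicol's (Ann. of Math. 189 (2019), §§4–5 and
App. B), rests on a handful of `L^p` bounds, `1 < p < ∞`, for translation-invariant operators on
`𝕋³`, all consequences of Calderón–Zygmund / Mihlin–Hörmander multiplier theory on `ℝⁿ`
(Grafakos 2014, Cor. 5.2.8, Thm. 6.2.7) transferred to the torus (Grafakos 2014, Thm. 4.3.7).
The tree already has the central one: the double-Riesz-transform bound
`FunctionSpaces.Torus.eLpNorm_hessian_le_laplacian d` (`‖∂ⱼ∂ₖw‖_p ≤ C‖Δw‖_p`,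
`FunctionSpaces/TorusRieszTransform`), PROVED for `#d ≤ 3` by transference from the tree's `ℝⁿ`
Calderón–Zygmund theory (`TorusRieszTransformProofs`, `TorusRieszTransformDimension`); the `L^p`
bounds of the Leray projector and of `ℛ∂ⱼ` are corollaries of it and are therefore NOT vendored
here but proved from it in the sibling file `TorusLpOperatorBounds` (theorems
`lerayHelmholtz_Lp_bound_of_hessian`, `antidivergence_partialDeriv_Lp_bound_of_hessian`, and
outright on `𝕋³`). What Mathlib and the tree do not have (Littlewood–Paley theory, fractional
multipliers, the endpoint `p = 1, ∞` bounds) is vendored here as NAMED FACTS (`def … : Prop`,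
D-0014), for the tree's own operators:

* `Torus.antidivergence_Lp_bound` — **Cheskidov–Luo 2022, Thm. 7.3**: the De Lellis–Székelyhidi
  antidivergence `ℛ` (`Torus.antidivergence`, `FluidPDE/Antidivergence`) is bounded on `L^p`,
  `1 ≤ p ≤ ∞`, on zero-mean fields (Luo–Titi Lemma 5: "`‖ℛ‖_{L^p→W^{1,p}} ≲ 1`"; BV19 §5:
  "the Schauder estimates `‖ℛ‖_{L^p→L^p} + ‖ℛ‖_{C⁰→C⁰} ≲ 1`");
* `Torus.lerayHelmholtz` (definition, with proved API: smoothness, `div P_LH u = 0`, identity on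
  divergence-free fields) — the Leray–Helmholtz projector `P_LH = Id - ∇Δ⁻¹div` on smooth
  fields (Luo–Titi §3.3); its `L^p` bound ("It is well-known that `P_LH` is bounded on `L^p`,
  `1 < p < ∞` (see, e.g., [Grafakos])") and BV19 §5's "`‖|∇|ℛ‖_{L^p→L^p} ≲ 1`" are the theorems
  of `TorusLpOperatorBounds`;
* `Torus.rieszPotential_Lp_bound` — `‖|∇|⁻¹P_{≠0} u‖_p ≲ ‖u‖_p` (BV19 App. B: "a direct
  consequence of Schauder estimates/Hardy–Littlewood–Sobolev"; Luo–Titi proof of Lemma 6), with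
  `|∇|⁻¹P_{≠0} = (-Δ)^{-1/2}` the tree's spectral `Torus.fracLaplacian (-1/2)` (symbol
  `(2π|k|)⁻¹` off the zero mode, `0` on it);
* `Torus.rieszPotential_Lp_bound_of_freqSupport` — the Bernstein-type bound
  `‖|∇|⁻¹ u‖_p ≲ κ⁻¹ ‖u‖_p` for fields with FOURIER SUPPORT in `{|k| ≥ κ}` (BV19 App. B:
  "`‖|∇|⁻¹ P_{≥κ/2}‖_{L^p→L^p} ≲ 1/κ`, a direct consequence of the Littlewood–Paley
  decomposition");
* `Torus.commutator_Lp_bound` — **BV19 Lemma B.1 / Luo–Titi Lemma 6 (commutator estimate)** in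
  the corrected, exact-support form
  `‖|∇|⁻¹P_{≠0}(a f)‖_p ≲ κ⁻¹ ‖a‖_{C²} ‖f‖_p` for `supp f̂ ⊂ {|k| ≥ κ}`;
* `Torus.fracLaplacian_moment_bound` — the moment inequality
  `‖(-Δ)^α u‖_p ≲ ‖u‖_p^{1-α} ‖Δu‖_p^α`, `0 < α < 1` (Pazy 1983, Thm. 2.6.10 (6.19), for
  `A = -Δ` on `L^p_0(𝕋^d)`), which turns Luo–Titi's integer-order bounds (3.13), (3.16) into the
  fractional `‖|∇|^{2θ-1} w‖_p` of the crucial estimate (3.20).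

## Where the rendering deliberately departs from the printed wording (read before attacking)

1. **Sharp Fourier projections are avoided.** Luo–Titi (§3.1) and BV19 (App. B) write the
   frequency cut-offs `P_{≥κ}`, `P_{≤κ/2}` as SHARP spherical Fourier projections and use
   "`‖P_{≤κ/2}‖_{L^p→L^p} ≲ 1`", "`‖|∇|⁻¹P_{≥κ/2}‖_{L^p→L^p} ≲ 1/κ`" uniformly in `κ`. For
   `p ≠ 2` such uniform bounds for sharp spherical cut-offs are false (the ball/annulus
   multiplier is unbounded on `L^p(ℝ³)`, Fefferman 1971, and uniform bounds on `𝕋³` would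
   transfer to `ℝ³`, Grafakos 2014, §4.3.2); the arguments are correct with smooth
   Littlewood–Paley cut-offs, and in the schemes the cut-offs are only ever applied to products
   of intermittent Beltrami waves whose Fourier support is known EXACTLY (Luo–Titi (3.5); BV19
   (3.14)–(3.15)). The facts below are therefore stated for fields with prescribed Fourier
   support (`Torus.IsFreqSupportedOff κ f`), never with a sharp projection inside an operator
   norm; in this form they are true (the relevant symbols `φ(k/κ)/(2π|k|)`, `φ` smooth, vanishing
   near `0` and `≡ 1` on `|ξ| ≥ 1/2`, are Mihlin multipliers uniformly in `κ`, indeed have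
   kernels bounded in `L¹` by `C/κ`).
2. **Luo–Titi's Lemma 6 omits the zeroth-order term.** As printed,
   "`‖|∇|⁻¹P_{≠0}(a P_{≥k} f)‖_{L^p} ≲ k⁻¹ ‖∇²a‖_{L^∞} ‖f‖_{L^p}`" fails for constant `a ≠ 0`
   (left side `|a| ‖|∇|⁻¹P_{≥k}f‖_p ≠ 0`, right side `0`); its source BV19 Lemma B.1 carries
   `C_a ≥ ‖a‖_{L^∞}` (`‖D^j a‖_{L^∞} ≤ C_a λ^j`, `0 ≤ j ≤ L`), and the printed proof's last step
   uses `W^{1,4} ⊂ L^∞` for the non-zero-mean `P_{≤k/2}a`. The fact below carries the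
   inhomogeneous norm `max_{j≤2} ‖D^j a‖_∞` (BV19's `C_a` with `λ = 1`, `L = 2`), which is what
   the application (Luo–Titi's `𝒞_N`, polynomials in `‖a_ξ‖_{C^N}`) provides anyway.
3. Operators are the tree's: `ℛ` is the De Lellis–Székelyhidi operator of
   `FluidPDE/Antidivergence` (symmetric AND trace-free; Luo–Titi's Lemma 5 operator is a
   different right inverse of `div`, but only the properties recorded here are used),
   `|∇|^s P_{≠0} = Torus.fracLaplacian (s/2)` (unit-torus symbol `(2π|k|)^s`), `P_LH` is
   `Torus.lerayHelmholtz`. Dimension: `𝕋^d`, `d ≥ 2`, where the sources are dimensionless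
   (Cheskidov–Luo, Grafakos, Pazy); `𝕋³` for the commutator estimate (BV19, Luo–Titi).
4. Norms of matrix fields (`ℛv x : d → ℝ^d`, columns) are the Pi sup-norm of the Euclidean
   column norms, as in `Torus.IsEulerReynoldsOn`; all such norms are equivalent, constants
   absorbed in `C`.

## References

* T. Luo, E. S. Titi, Calc. Var. PDE 59 (2020) = arXiv:1808.07595, §3.3 (Leray projector),
  §3.5 Lemma 5, Lemma 6, (3.20). [`LuoTiti2020`]
* T. Buckmaster, V. Vicol, Ann. of Math. 189 (2019) = arXiv:1709.10033, §5 (the operator `ℛ`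
  and its bounds), App. B Lemma B.1 and its proof. [`BuckmasterVicol2019AnnMath`]
* A. Cheskidov, X. Luo, Invent. Math. 229 (2022) = arXiv:2009.06596, §7.2 Def. 7.2, Thm. 7.3.
  [`CheskidovLuo2022`]
* L. Grafakos, *Classical Fourier Analysis*, 3rd ed. (2014), Thm. 4.3.7 (transference),
  Cor. 5.2.8 (Riesz transforms), Thm. 6.2.7 (Mihlin–Hörmander). [`Grafakos2014`]
* A. Pazy, *Semigroups of Linear Operators and Applications to PDE* (1983), §2.6,
  Thm. 6.10 (6.18)–(6.19). [`Pazy1983`]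
-/

noncomputable section

open MeasureTheory Set Filter Function UnitAddTorus
open scoped ENNReal NNReal ContDiff

namespace Literature.Analysis.FluidPDE

namespace Torus

open FunctionSpaces FunctionSpaces.Torus

variable {d : Type*} [Fintype d] [DecidableEq d]

/-! ## Fourier support off a ball -/

/-- A real vector field `f` on `T^d` has **Fourier support off the ball of radius `κ`**:
`f̂(k) = 0` whenever `|k| < κ` (coefficients of the complexified field, as in
`Torus.fracLaplacian`). For the intermittent Beltrami waves this is the exact frequency
localisation `P_{≥λ/2} 𝕎_ξ = 𝕎_ξ`, `P_{≥λ/10}(𝕎_ξ ⊗ 𝕎_ξ') = 𝕎_ξ ⊗ 𝕎_ξ'` (`ξ + ξ' ≠ 0`) of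
Luo–Titi (3.5). [cite: LuoTiti2020, §3.2 (3.5)] -/
def IsFreqSupportedOff (κ : ℝ) (f : UnitAddTorus d → EuclideanSpace ℝ d) : Prop :=
  ∀ k : d → ℤ, freqNormSq k < κ ^ 2 → mFourierCoeff (EuclideanSpace.complexify ∘ f) k = 0

omit [DecidableEq d] in
/-- Fourier support off a larger ball implies Fourier support off a smaller one. [folklore] -/
theorem IsFreqSupportedOff.mono {κ κ' : ℝ} {f : UnitAddTorus d → EuclideanSpace ℝ d}
    (h : IsFreqSupportedOff κ f) (hκ : κ' ≤ κ) (hκ' : 0 ≤ κ') : IsFreqSupportedOff κ' f :=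
  fun k hk => h k (hk.trans_le (pow_le_pow_left₀ hκ' hκ 2))

omit [DecidableEq d] in
/-- The zero field has Fourier support off every ball. [folklore] -/
theorem isFreqSupportedOff_zero (κ : ℝ) :
    IsFreqSupportedOff κ (0 : UnitAddTorus d → EuclideanSpace ℝ d) := by
  intro k _
  have h : (EuclideanSpace.complexify ∘ (0 : UnitAddTorus d → EuclideanSpace ℝ d)) = 0 := by
    funext y; simp
  rw [h]
  simp [mFourierCoeff]

/-! ## The antidivergence: `L^p` bounds (named facts) -/

variable (d) in
/-- **Cheskidov–Luo 2022, Thm. 7.3 — `ℛ` is bounded on `L^p(𝕋^d)`, `1 ≤ p ≤ ∞`, named fact.**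
*Printed:* "Let `1 ≤ p ≤ ∞`. For any `f ∈ C^∞_0(𝕋^d)`, there holds
`‖ℛf‖_{L^p(𝕋^d)} ≲ ‖f‖_{L^p(𝕋^d)}`" (`C^∞_0` = smooth with zero mean; `ℛ` of their Def. 7.2 =
`Torus.antidivergence`, `d ≥ 2`). Rendering: for every `p ∈ [1, ∞]` a constant `C` (depending
on `p` and `d`) with `‖ℛv‖_{L^p} ≤ C ‖v‖_{L^p}` for all smooth zero-mean `v : T^d → ℝ^d`.
This contains Luo–Titi's "`‖ℛ‖_{L^p→L^p}`" part of Lemma 5 and BV19's "`‖ℛ‖_{L^p→L^p} ≲ 1`".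
Not proved here (Riesz transforms on `𝕋^d` for `1 < p < ∞`, Sobolev embedding and duality at
the endpoints). [cite: CheskidovLuo2022, §7.2 Thm. 7.3] -/
def antidivergence_Lp_bound : Prop :=
  2 ≤ Fintype.card d →
    ∀ p : ℝ≥0∞, 1 ≤ p → ∃ C : ℝ≥0, ∀ v : UnitAddTorus d → EuclideanSpace ℝ d,
      IsSmooth v → HasZeroMean v →
        eLpNorm (antidivergence v) p volume ≤ C * eLpNorm v p volume

/-! ## The Leray–Helmholtz projector on smooth fields -/

/-- **The Leray–Helmholtz projector on smooth fields**, `P_LH u = u - ∇Δ⁻¹ div u` (Luo–Titi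
§3.3: "`P_LH = Id - ∇Δ⁻¹div` is the Leray–Helmholtz projection into Torus.divergence-free vector
field[s]"), with the tree's `Torus.invLaplacian` (zero-mean inverse Laplacian,
`Δ Δ⁻¹h = h - ⨍h`). Intended for smooth `u`; it keeps the mean of `u`. The scalar `Δ⁻¹ div u`
is the tree's `Torus.helmholtzPotential` of `TorusLerayHelmholtzSpaceTime` (Fourier-side
construction, `helmholtzPotential_eq_invLaplacian_divergence`; not imported here), and the
`L²`-class projector is `Torus.lerayProjector` of `FluidPDE/LerayProjector`. [cite: LuoTiti2020, §3.3] -/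
def lerayHelmholtz (u : UnitAddTorus d → EuclideanSpace ℝ d) : UnitAddTorus d → EuclideanSpace ℝ d :=
  u - Torus.gradient (invLaplacian (Torus.divergence u))

/-- Unfolding `lerayHelmholtz`. [folklore] -/
theorem lerayHelmholtz_apply (u : UnitAddTorus d → EuclideanSpace ℝ d) (x : UnitAddTorus d) :
    lerayHelmholtz u x = u x - Torus.gradient (invLaplacian (Torus.divergence u)) x := rfl

/-- `P_LH u` is smooth for smooth `u`. [folklore] -/
theorem isSmooth_lerayHelmholtz {u : UnitAddTorus d → EuclideanSpace ℝ d} (hu : IsSmooth u) :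
    IsSmooth (lerayHelmholtz u) :=
  hu.sub (isSmooth_invLaplacian hu.divergence).gradient

/-- Coordinates of the Torus.gradient: `(∇θ)ᵢ = ∂ᵢθ` for `C¹` scalar `θ` (the tree's canonical twin is
`FunctionSpaces.Torus.gradient_apply` of `TorusMollifierEstimates`, which is not in the import
closure of this facts file, kept light). [folklore] -/
theorem gradient_coord {θ : UnitAddTorus d → ℝ} (hθ : IsContDiff 1 θ) (x : UnitAddTorus d) (i : d) :
    Torus.gradient θ x i = Torus.partialDeriv i θ x := by
  have h := inner_gradient_left θ x (EuclideanSpace.single i (1 : ℝ))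
  rw [EuclideanSpace.inner_single_right] at h
  simp only [one_mul, RCLike.conj_to_real] at h
  rw [h, partialDeriv_eq_fderiv_apply hθ]

/-- `div ∇θ = Δθ` for smooth `θ` (twin of `divergence_gradient_eq_laplacian` in
`FluidPDE/DuchonRobertPressure`, not imported). [folklore] -/
theorem divergence_gradient {θ : UnitAddTorus d → ℝ} (hθ : IsSmooth θ) (x : UnitAddTorus d) :
    Torus.divergence (Torus.gradient θ) x = Torus.laplacian θ x := by
  rw [laplacian_eq_sum_partialDeriv_partialDeriv hθ, Torus.divergence]
  refine Finset.sum_congr rfl fun i _ => ?_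
  have : (fun y => Torus.gradient θ y i) = Torus.partialDeriv i θ :=
    funext fun y => gradient_coord (hθ.isContDiff (by simp)) y i
  rw [this]

/-- **`P_LH u` is Torus.divergence free** for smooth `u` (`div(u - ∇Δ⁻¹div u) = div u - (div u -
⨍ div u) = ⨍ div u = 0` by the Torus.divergence theorem on `T^d`). [cite: LuoTiti2020, §3.3] -/
theorem isDivFree_lerayHelmholtz [Nonempty d] {u : UnitAddTorus d → EuclideanSpace ℝ d}
    (hu : IsSmooth u) : IsDivFree (lerayHelmholtz u) := by
  intro x
  have hφ : IsSmooth (invLaplacian (Torus.divergence u)) := isSmooth_invLaplacian hu.divergence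
  have hgrad : IsSmooth (Torus.gradient (invLaplacian (Torus.divergence u))) := hφ.gradient
  rw [lerayHelmholtz, divergence_sub (hu.isContDiff (by simp)) (hgrad.isContDiff (by simp)),
    divergence_gradient hφ, laplacian_invLaplacian hu.divergence, integral_divergence_eq_zero_holds hu]
  ring

/-- On a smooth Torus.divergence-free field `P_LH` is the identity (`Δ⁻¹ 0 = 0`, `∇0 = 0`). [folklore] -/
theorem lerayHelmholtz_of_isDivFree {u : UnitAddTorus d → EuclideanSpace ℝ d} (hdiv : IsDivFree u) :
    lerayHelmholtz u = u := by
  have h0 : Torus.divergence u = 0 := funext hdiv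
  funext x
  rw [lerayHelmholtz_apply, h0, invLaplacian_zero]
  have hc : IsContDiff 1 (0 : UnitAddTorus d → ℝ) := isContDiff_const (0 : ℝ)
  have : Torus.gradient (0 : UnitAddTorus d → ℝ) x = 0 := by
    ext i
    rw [gradient_coord hc x i]
    have h := partialDeriv_const_apply (d := d) (0 : ℝ) i x
    simp only [PiLp.zero_apply]
    exact h
  rw [this, sub_zero]

/-! ## The Riesz potential `|∇|⁻¹P_{≠0} = (-Δ)^{-1/2}` -/

variable (d) in
/-- **`|∇|⁻¹P_{≠0}` is bounded on `L^p(𝕋^d)`, `1 < p < ∞`, named fact** (BV19, proof of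
Lemma B.1: "the bound `‖|∇|⁻¹P_{≠0}‖_{L^p→L^p} ≲ 1` which is a direct consequence of Schauder
estimates/Hardy–Littlewood–Sobolev"; the same in Luo–Titi's proof of Lemma 6). Here
`|∇|⁻¹P_{≠0} = Torus.fracLaplacian (-1/2)` (symbol `(4π²|k|²)^{-1/2} = (2π|k|)⁻¹` for
`k ≠ 0`, and `0^{-1/2} = 0` at `k = 0`). Rendering: for `1 < p < ∞` a constant `C` with
`‖(-Δ)^{-1/2}u‖_{L^p} ≤ C ‖u‖_{L^p}` for all smooth `u : T^d → ℝ^d`. Not proved here (the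
kernel is integrable, `∼ |x|^{1-d}` at the origin). [cite: BuckmasterVicol2019AnnMath, App. B proof of Lemma B.1] -/
def rieszPotential_Lp_bound : Prop :=
  ∀ p : ℝ≥0∞, 1 < p → p < ⊤ → ∃ C : ℝ≥0, ∀ u : UnitAddTorus d → EuclideanSpace ℝ d,
    IsSmooth u → eLpNorm (fracLaplacian (-(1 / 2)) u) p volume ≤ C * eLpNorm u p volume

variable (d) in
/-- **Bernstein-type bound for `|∇|⁻¹` at frequencies `≥ κ`, named fact** (BV19, proof of
Lemma B.1: "`‖|∇|⁻¹P_{≥κ/2}‖_{L^p→L^p} ≲ 1/κ`, which is a direct consequence of the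
Littlewood–Paley decomposition"). Rendering (see the file header, item 1, for why no sharp
projection appears): for `1 < p < ∞` a constant `C` such that for every `κ ≥ 1` and every smooth
`u : T^d → ℝ^d` whose Fourier coefficients vanish on `{|k| < κ}`,
`‖(-Δ)^{-1/2}u‖_{L^p} ≤ C κ⁻¹ ‖u‖_{L^p}`. Not proved here (the multiplier `φ(k/κ)/(2π|k|)`
with a smooth cut-off `φ ≡ 1` on `|ξ| ≥ 1`, `φ ≡ 0` near `0`, agrees with `(2π|k|)⁻¹` on the
Fourier support of `u` and has kernel of `L¹` norm `≤ C/κ`).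
[cite: BuckmasterVicol2019AnnMath, App. B proof of Lemma B.1] -/
def rieszPotential_Lp_bound_of_freqSupport : Prop :=
  ∀ p : ℝ≥0∞, 1 < p → p < ⊤ → ∃ C : ℝ≥0, ∀ κ : ℝ, 1 ≤ κ →
    ∀ u : UnitAddTorus d → EuclideanSpace ℝ d, IsSmooth u → IsFreqSupportedOff κ u →
      eLpNorm (fracLaplacian (-(1 / 2)) u) p volume ≤ C * ENNReal.ofReal κ⁻¹ * eLpNorm u p volume

/-! ## The commutator estimate (Luo–Titi Lemma 6 / BV19 Lemma B.1) -/

/-- **Luo–Titi 2020, Lemma 6 = Buckmaster–Vicol 2019, Lemma B.1 (commutator estimate), named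
fact, in the corrected exact-support form.** *Printed (Luo–Titi):* "Let `a ∈ C²(𝕋³)`. For
`1 < p < ∞`, and any smooth function `f ∈ L^p(𝕋³)`, we have
`‖|∇|⁻¹P_{≠0}(a P_{≥k} f)‖_{L^p(𝕋³)} ≲ k⁻¹ ‖∇²a‖_{L^∞(𝕋³)} ‖f‖_{L^p(𝕋³)}`." *Printed (BV19,
Lemma B.1):* "Fix `κ ≥ 1`, `p ∈ (1,2]`, and a sufficiently large `L ∈ ℕ`. Let `a ∈ C^L(𝕋³)`
be such that there exists `1 ≤ λ ≤ κ`, and `C_a > 0` with `‖D^j a‖_{L^∞} ≤ C_a λ^j` for all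
`0 ≤ j ≤ L`. Assume furthermore that `∫ a P_{≥κ}f = 0`. Then
`‖|∇|⁻¹(a P_{≥κ}f)‖_{L^p} ≲ C_a (1 + λ^L/κ^{L-2}) ‖f‖_{L^p}/κ` for any `f ∈ L^p(𝕋³)`."
Rendering (file header, items 1–2): `λ = 1`, `L = 2` (so the factor is `2C_a/κ`), with
`C_a = A ≥ max_{j ≤ 2} ‖D^j a‖_{L^∞}` INCLUDING `j = 0` (Luo–Titi's display omits `‖a‖_{L^∞}`,
which is false for constant `a`); `f` smooth with Fourier support in `{|k| ≥ κ}` (in place of a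
sharp `P_{≥κ}` applied to an arbitrary `f`); the zero mode is removed by `|∇|⁻¹P_{≠0} =
(-Δ)^{-1/2}` (Luo–Titi's form; BV19 assume `∫ a P_{≥κ} f = 0` instead); all `1 < p < ∞`; on
`𝕋³` as printed, for vector-valued `f` (componentwise) and scalar `a`. Not proved here
(Littlewood–Paley: split `a` at frequency `κ/2` with a smooth cut-off, use
`rieszPotential_Lp_bound_of_freqSupport` on the low part and `‖a - P̃_{≤κ/2}a‖_∞ ≲
κ⁻²‖D²a‖_∞` with `rieszPotential_Lp_bound` on the high part). Tags: the statement is a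
weakening of Luo–Titi's Lemma 6 with its hypotheses (`a ∈ C²(𝕋³)`, `1 < p < ∞`, smooth `f`; exact
support = the case `P_{≥κ}f = f`; `max_{j≤2}‖D^ja‖_∞ ≥ ‖∇²a‖_∞`) and with the zeroth-order term
restored from [cite: BuckmasterVicol2019AnnMath, App. B Lemma B.1] (whose own hypotheses,
`p ∈ (1,2]`, `a ∈ C^L`, `L` large, are different). [cite: LuoTiti2020, §3.5 Lemma 6] -/
def commutator_Lp_bound : Prop :=
  ∀ p : ℝ≥0∞, 1 < p → p < ⊤ → ∃ C : ℝ≥0, ∀ κ : ℝ, 1 ≤ κ →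
    ∀ (a : UnitAddTorus (Fin 3) → ℝ) (A : ℝ), IsSmooth a →
      (∀ j ≤ 2, ∀ y, ‖iteratedFDeriv ℝ j (lift a) y‖ ≤ A) →
      ∀ f : UnitAddTorus (Fin 3) → EuclideanSpace ℝ (Fin 3), IsSmooth f → IsFreqSupportedOff κ f →
        eLpNorm (fracLaplacian (-(1 / 2)) (fun x => a x • f x)) p volume ≤
          C * ENNReal.ofReal (κ⁻¹ * A) * eLpNorm f p volume

/-! ## The moment inequality for `(-Δ)^α`, `0 < α < 1` -/

variable (d) in
/-- **The moment inequality for fractional powers of `-Δ` on `L^p(𝕋^d)`, named fact** — Pazy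
1983, §2.6, Thm. 6.10 (6.19): "Let `0 < α < 1`. There exists a constant `C₀ > 0` such that for
every `x ∈ D(A)` … `‖A^α x‖ ≤ 2C₀ ‖x‖^{1-α} ‖Ax‖^α`", for `A` satisfying Assumption 6.1 (densely
defined, closed, sectorial resolvent bound, `0 ∈ ρ(A)`), applied to `A = -Δ` on the zero-mean
subspace of `L^p(𝕋^d)`, `1 < p < ∞` (generator of the analytic heat semigroup, invertible on
zero-mean functions), whose fractional power on smooth fields is the spectral
`Torus.fracLaplacian α` (symbol `(4π²|k|²)^α`). Rendering: for `0 < α < 1` and `1 < p < ∞` a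
constant `C` with `‖(-Δ)^α u‖_{L^p} ≤ C ‖u‖_{L^p}^{1-α} ‖Δu‖_{L^p}^α` for every smooth
`u : T^d → ℝ^d` (no zero-mean hypothesis is needed: `(-Δ)^α` and `Δ` annihilate the mean and
`‖u - ⨍u‖_p ≤ 2‖u‖_p`, constant absorbed). With `α = θ - 1/2 ∈ [1/2, 3/4)` this converts
Luo–Titi's (3.13) and (3.16) (`N = 2`) into the bound `‖|∇|^{2θ-1} w_{q+1}‖_{L^p} ≲
r^{3/2-3/p} λ_{q+1}^{2θ-1} 𝒞₃` of (3.20). Not proved here. [cite: Pazy1983, §2.6 Thm. 6.10 (6.19)] -/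
def fracLaplacian_moment_bound : Prop :=
  ∀ α : ℝ, 0 < α → α < 1 → ∀ p : ℝ≥0∞, 1 < p → p < ⊤ → ∃ C : ℝ≥0,
    ∀ u : UnitAddTorus d → EuclideanSpace ℝ d, IsSmooth u →
      eLpNorm (fracLaplacian α u) p volume ≤
        C * eLpNorm u p volume ^ (1 - α) * eLpNorm (Torus.laplacian u) p volume ^ α

end Torus

end Literature.Analysis.FluidPDE
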